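import Mathlib
import HarnessLib
import Summits.HubbardSuperconductivity.HubbardSuperconductivity.Theorems.KLProgrammeKLRegimeScaleZeroTwoLegTail3

/-!
# Route `KLProgramme`, ENGINE child (stmt-…-20437), stub (C) at `n = 0` (located #22, piece (a3)): from PLAIN covariance moments to the scaled-weight
# hypothesis of the tail doors (binomial bridge)

Cell gate-hubbard-kl, seat p1 (g18).  The tail doors of `…ScaleZeroTwoLegTail3 / …OnSite / …TailN` take the covariance size against the SCALED tree weight
`(1 + λ·d)ᵏ` (`d = gridLabelDist`, time included): `Σ_Y ‖C X Y‖·(1+λ·d(X,Y))ᵏ ≤ a·4M/β`.  A decay supplier ([B1]: k3c5-p1's π3 / the Gevrey-tail route of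
the p2 lineage) naturally produces the PLAIN moments `Σ_Y ‖C X Y‖·d(X,Y)ʲ ≤ m_j·4M/β`, `j ≤ k`.  By the binomial theorem the former is EXACTLY
`Σ_j C(k,j)λʲ·(j-th moment sum)`, so

* `sum_mul_scaledPolyWt_pair_eq` — `Σ_Y g(Y)·(1+λd(X,Y))ᵏ = Σ_{j≤k} C(k,j)λʲ·Σ_Y g(Y)d(X,Y)ʲ` for any `g` (row or column alike);
* **`sum_mul_scaledPolyWt_pair_le_of_moments`** — `… ≤ Σ_{j≤k} C(k,j)λʲ·m_j` from `Σ_Y g(Y)d(X,Y)ʲ ≤ m_j` (`λ ≥ 0`);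
* `binomialMoment_le_two_pow_mul` — if `λʲ·m_j ≤ m₀` for all `j ≤ k` then `Σ_{j≤k} C(k,j)λʲm_j ≤ 2ᵏ·m₀`: the choice `λ ≤ min_j (m₀/m_j)^{1/j}` makes the
  doors' `a` equal to `2ᵏ·a₀` — the order-`k` moment is paid ONCE through the factor `(2/λ)ᵏ` of the doors, not on every covariance line.

Pure bookkeeping over `Finset.sum` and `add_pow`; no definition; everything PROVED.
-/

noncomputable section

namespace Summit.HubbardSuperconductivity.HubbardSuperconductivity.Theorems.EngineV8

set_option linter.dupNamespace false -- summit = problem name (single-conjunct summit), D-0017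

open Real Finset Literature.MathematicalPhysics.QuantumLattice Literature.Probability.LatticeModels
open Literature.Probability.LatticeModels.BattleFederbush GrassmannAlgebra
open Summit.HubbardSuperconductivity.HubbardSuperconductivity.Theorems.KLRegimeSplit

variable {L N : ℕ} [NeZero L] [NeZero N]

/-- **Binomial expansion of the scaled pair weight against any density `g`**: for `β′ ≥ 0`, any `λ`, any `k`, any pinned label `X`,
`Σ_Y g(Y)·wt_{λ,k}{X,Y} = Σ_{j ∈ range (k+1)} C(k,j)·λʲ·Σ_Y g(Y)·d(X,Y)ʲ`, `d = gridLabelDist L N β′ ∘ gridLegPos`. -/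
theorem sum_mul_scaledPolyWt_pair_eq {β' : ℝ} (hβ' : 0 ≤ β') (lam : ℝ) (k : ℕ) (g : GridLeg (GridPoint L N) → ℝ)
    (X : GridLeg (GridPoint L N)) :
    ∑ Y, g Y * diamWeight (fun s => (1 + lam * s) ^ k) (gridLabelDist L N β') {gridLegPos X, gridLegPos Y} =
      ∑ j ∈ range (k + 1), (k.choose j : ℝ) * lam ^ j *
        ∑ Y, g Y * gridLabelDist L N β' (gridLegPos X) (gridLegPos Y) ^ j := by
  have hd := isLabelDist_gridLabelDist L N hβ'
  have hpt : ∀ Y, diamWeight (fun s => (1 + lam * s) ^ k) (gridLabelDist L N β') {gridLegPos X, gridLegPos Y} =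
      ∑ j ∈ range (k + 1), (k.choose j : ℝ) * lam ^ j * gridLabelDist L N β' (gridLegPos X) (gridLegPos Y) ^ j := by
    intro Y
    rw [diamWeight_pair hd, add_comm, add_pow]
    refine sum_congr rfl fun j _ => ?_
    rw [mul_pow, one_pow, mul_one]
    ring
  simp_rw [hpt, mul_sum]
  rw [sum_comm]
  refine sum_congr rfl fun j _ => ?_
  refine sum_congr rfl fun Y _ => ?_
  ring

/-- **From plain moments to the scaled-weight size** (the `hrow`/`hcol` hypothesis of the tail doors): if `g ≥ 0`-free — for ANY real `g` — the plain
moments obey `Σ_Y g(Y)·d(X,Y)ʲ ≤ m j` for `j ≤ k`, and `λ ≥ 0`, then `Σ_Y g(Y)·(1+λ·d(X,Y))ᵏ ≤ Σ_{j ∈ range (k+1)} C(k,j)·λʲ·m j`. -/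
theorem sum_mul_scaledPolyWt_pair_le_of_moments {β' : ℝ} (hβ' : 0 ≤ β') {lam : ℝ} (hlam : 0 ≤ lam) (k : ℕ)
    (g : GridLeg (GridPoint L N) → ℝ) {m : ℕ → ℝ} (X : GridLeg (GridPoint L N))
    (hm : ∀ j ≤ k, ∑ Y, g Y * gridLabelDist L N β' (gridLegPos X) (gridLegPos Y) ^ j ≤ m j) :
    ∑ Y, g Y * diamWeight (fun s => (1 + lam * s) ^ k) (gridLabelDist L N β') {gridLegPos X, gridLegPos Y} ≤
      ∑ j ∈ range (k + 1), (k.choose j : ℝ) * lam ^ j * m j := by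
  rw [sum_mul_scaledPolyWt_pair_eq hβ' lam k g X]
  refine sum_le_sum fun j hj => ?_
  exact mul_le_mul_of_nonneg_left (hm j (Nat.lt_succ_iff.1 (mem_range.1 hj))) (by positivity)

/-- **The column twin** (symmetry of the label distance): `Σ_X g(X)·wt_{λ,k}{X,Y} ≤ Σ_j C(k,j)λʲ·m j` from the plain column moments
`Σ_X g(X)·d(X,Y)ʲ ≤ m j`. -/
theorem sum_mul_scaledPolyWt_pair_le_of_moments' {β' : ℝ} (hβ' : 0 ≤ β') {lam : ℝ} (hlam : 0 ≤ lam) (k : ℕ)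
    (g : GridLeg (GridPoint L N) → ℝ) {m : ℕ → ℝ} (Y : GridLeg (GridPoint L N))
    (hm : ∀ j ≤ k, ∑ X, g X * gridLabelDist L N β' (gridLegPos X) (gridLegPos Y) ^ j ≤ m j) :
    ∑ X, g X * diamWeight (fun s => (1 + lam * s) ^ k) (gridLabelDist L N β') {gridLegPos X, gridLegPos Y} ≤
      ∑ j ∈ range (k + 1), (k.choose j : ℝ) * lam ^ j * m j := by
  have hd := isLabelDist_gridLabelDist L N hβ'
  have hsymm : ∀ X, ({gridLegPos X, gridLegPos Y} : Finset (ZMod N × TorusSite 2 L)) = {gridLegPos Y, gridLegPos X} :=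
    fun X => Finset.pair_comm _ _
  have hm' : ∀ j ≤ k, ∑ X, g X * gridLabelDist L N β' (gridLegPos Y) (gridLegPos X) ^ j ≤ m j := by
    intro j hj
    simpa only [hd.symm] using hm j hj
  simpa only [hsymm] using sum_mul_scaledPolyWt_pair_le_of_moments hβ' hlam k g Y hm'

/-- **The `λ`-choice arithmetic**: if `0 ≤ λ`, and `λʲ·m j ≤ m₀` for every `j ≤ k` (e.g. `λ ≤ min_j (m₀/m_j)^{1/j}`), then
`Σ_{j ∈ range (k+1)} C(k,j)·λʲ·m j ≤ 2ᵏ·m₀`. -/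
theorem binomialMoment_le_two_pow_mul {lam m₀ : ℝ} {m : ℕ → ℝ} (k : ℕ) (h : ∀ j ≤ k, lam ^ j * m j ≤ m₀) :
    ∑ j ∈ range (k + 1), (k.choose j : ℝ) * lam ^ j * m j ≤ (2 : ℝ) ^ k * m₀ := by
  calc ∑ j ∈ range (k + 1), (k.choose j : ℝ) * lam ^ j * m j
      = ∑ j ∈ range (k + 1), (k.choose j : ℝ) * (lam ^ j * m j) := sum_congr rfl fun j _ => by ring
    _ ≤ ∑ j ∈ range (k + 1), (k.choose j : ℝ) * m₀ :=
        sum_le_sum fun j hj => mul_le_mul_of_nonneg_left (h j (Nat.lt_succ_iff.1 (mem_range.1 hj))) (Nat.cast_nonneg _)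
    _ = (∑ j ∈ range (k + 1), (k.choose j : ℝ)) * m₀ := by rw [sum_mul]
    _ = (2 : ℝ) ^ k * m₀ := by
        congr 1
        have h2 := Nat.sum_range_choose k
        exact_mod_cast h2

end Summit.HubbardSuperconductivity.HubbardSuperconductivity.Theorems.EngineV8

end
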